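import Literature.Geometry.Symplectic.GromovMcDuffTwistedSphereProofs
import Literature.Topology.FourManifolds.ChartTransport
import Literature.Geometry.Symplectic.GromovR4RelEnd

/-!
# Helper `helper_sphere_of_diffeomorph_punctured_chartBall` of line `stable-seam-host` for crux
`OrigamiFoldExistence` (item stmt-SmoothPoincare4-7844; brick R3 of the round-seam rung)

Endgame of the round-seam rung: let `S` be a compact smooth `4`-manifold, `e : ℝ⁴ → S` a smooth
embedding of the whole model space (a global chart ball) with centre `p = e 0`, and
`Φ : S ∖ {p} ≃ₘ ℝ⁴` a diffeomorphism which, on a small punctured chart ball `e(B(0, ρ)) ∖ {p}`,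
is `L ∘ ι ∘ e⁻¹` with `ι z = z / ‖z‖²` the inversion (`Literature.Geometry.Symplectic.inversion`)
and `L` an invertible continuous linear map.  **Then `S ≅ S⁴`.**

Proof (the template is `Literature.Geometry.Symplectic.isTwistedSphere_refl_of_diffeomorph_punctured`
/ `nonempty_diffeomorph_sphere_of_diffeomorph_punctured`, `GromovMcDuffTwistedSphereProofs.lean`,
where the chart is Mathlib's `chartAt p`; here it is the global embedding `e`):

* replacing `Φ` by `L⁻¹ ∘ Φ` (a continuous linear equivalence is a diffeomorphism,
  `ContinuousLinearEquiv.toDiffeomorph`) we may assume `L = id`;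
* `e` is a diffeomorphism onto an open subset, packaged as a smooth chart `c` of `S` with
  `c.symm = e` and full target (`Literature.Topology.FourManifolds.exists_chart_of_isSmoothEmbedding`);
* for `δ = ρ / 2` the two smooth embeddings `jA a = e (δ a)` and `jB b = Φ⁻¹ (δ⁻¹ b)` of the closed
  unit disc `𝔻⁴` (`Literature.Geometry.Symplectic.isSmoothEmbedding_comp_coe_closedBall`) cover `S` and
  meet exactly along the unit sphere, identically (`‖Φ (jA a)‖ = (δ‖a‖)⁻¹ ≥ δ⁻¹ ≥ ‖Φ (jB b)‖` and
  `ι (δ a) = δ⁻¹ a` for `‖a‖ = 1`), so `S` is the double `𝔻⁴ ∪_{id} 𝔻⁴`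
  (`Literature.Topology.FourManifolds.IsTwistedSphere 3 (Diffeomorph.refl …) S`);
* so is `S⁴` (`isTwistedSphere_refl_sphere isDouble_sphere_holds`), and gluings of two discs along
  the same diffeomorphism are diffeomorphic
  (`Literature.Topology.FourManifolds.nonempty_diffeomorph_of_isTwistedSphere`, Hirsch 1976,
  Ch. 8 Thm. 2.1, proved in `BallGluingUniqueness.lean`).

## References

* J. Milnor, *Lectures on the h-cobordism theorem* (1965), §9 (twisted spheres).
* M. W. Hirsch, *Differential Topology*, GTM 33 (1976), Ch. 8, Thm. 2.1.
* J. M. Lee, *Introduction to Smooth Manifolds*, 2nd ed. (2013), Ch. 4–5.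
-/

noncomputable section

-- the prescribed namespace `Summit.<P>.<Sub>.…` duplicates `SmoothPoincare4` (P = Sub)
set_option linter.dupNamespace false

open scoped Manifold ContDiff Topology
open Set Function Metric
open Literature.Topology.FourManifolds Literature.Geometry.Symplectic

namespace Summit.SmoothPoincare4.SmoothPoincare4.Theorems.OrigamiFoldExistence.StableSeamHost

/-- **A Hausdorff smooth `4`-manifold `S` with a global chart ball `e : ℝ⁴ ↪ S` and a
diffeomorphism `Φ : S ∖ {e 0} ≃ₘ ℝ⁴` equal to `ι ∘ e⁻¹` on a punctured chart ball `e(B(0, ρ)) ∖ {e 0}`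
is the double `𝔻⁴ ∪_{id} 𝔻⁴`** (`IsTwistedSphere 3 (Diffeomorph.refl) S`): the two discs are
`a ↦ e (δ a)` and `b ↦ Φ⁻¹ (δ⁻¹ b)` for `δ = ρ / 2`; they cover `S` and meet exactly along the unit
sphere, identically.  Adapted from
`Literature.Geometry.Symplectic.isTwistedSphere_refl_of_diffeomorph_punctured` (chart `chartAt p`
replaced by the global embedding `e`).  Milnor (1965), §9; Hirsch (1976), §8.2. [folklore] -/
private theorem isTwistedSphere_refl_of_diffeomorph_punctured_chartBall
    {S : Type*} [TopologicalSpace S] [T2Space S] [ChartedSpace (EuclideanSpace ℝ (Fin 4)) S]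
    [IsManifold (𝓡 4) ∞ S] (e : EuclideanSpace ℝ (Fin 4) → S)
    (he : Manifold.IsSmoothEmbedding (𝓡 4) (𝓡 4) ∞ e) {ρ : ℝ} (hρ : 0 < ρ) {p : S} (hp : e 0 = p)
    (Φ : (punctured p) ≃ₘ⟮𝓡 4, 𝓡 4⟯ EuclideanSpace ℝ (Fin 4))
    (hΦ : ∀ (x : punctured p) (y : EuclideanSpace ℝ (Fin 4)), x.1 = e y → ‖y‖ < ρ →
      Φ x = inversion y) :
    IsTwistedSphere 3
      (Diffeomorph.refl (𝓡 3) (Metric.sphere (0 : EuclideanSpace ℝ (Fin 4)) 1) ∞) S := by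
  -- the global chart `c` of `S` with `c.symm = e` and full target
  obtain ⟨c, hct, hcsymm, -, hcs⟩ :=
    exists_chart_of_isSmoothEmbedding (E := EuclideanSpace ℝ (Fin 4)) he
  subst hcsymm
  set δ : ℝ := ρ / 2 with hδ_def
  have hδ : 0 < δ := half_pos hρ
  have hδρ : δ < ρ := half_lt_self hρ
  have hδinv : 0 < δ⁻¹ := inv_pos.2 hδ
  have hne : ∀ x : punctured p, (x : S) ≠ p := fun x => mem_punctured.1 x.2
  have hnormδ : ∀ y : EuclideanSpace ℝ (Fin 4), ‖δ • y‖ = δ * ‖y‖ := fun y => by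
    rw [norm_smul, Real.norm_eq_abs, abs_of_pos hδ]
  have hinj : Injective (c.symm : EuclideanSpace ℝ (Fin 4) → S) := he.isEmbedding.injective
  -- the linear reparametrisation `A y = δ • y` of the model space
  set A : EuclideanSpace ℝ (Fin 4) ≃ₜ EuclideanSpace ℝ (Fin 4) :=
    { toFun := fun y => δ • y
      invFun := fun z => δ⁻¹ • z
      left_inv := fun y => by simp [smul_smul, inv_mul_cancel₀ hδ.ne']
      right_inv := fun z => by simp [smul_smul, mul_inv_cancel₀ hδ.ne']
      continuous_toFun := by fun_prop
      continuous_invFun := by fun_prop } with hA_def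
  -- the first disc: the closed chart-ball `e (B̄(0, δ))`
  set gA : OpenPartialHomeomorph (EuclideanSpace ℝ (Fin 4)) S :=
    A.toOpenPartialHomeomorph ≫ₕ c.symm with hgA_def
  have hgAsrc' : gA.source = univ := by
    rw [hgA_def, OpenPartialHomeomorph.trans_source, Homeomorph.toOpenPartialHomeomorph_source,
      univ_inter, OpenPartialHomeomorph.symm_source, hct, preimage_univ]
  have hgAsrc : Metric.closedBall (0 : EuclideanSpace ℝ (Fin 4)) 1 ⊆ gA.source := by
    rw [hgAsrc']; exact subset_univ _
  have hgAs : ContMDiffOn 𝓘(ℝ, EuclideanSpace ℝ (Fin 4)) (𝓡 4) ∞ gA gA.source := by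
    have h1 : ContMDiff 𝓘(ℝ, EuclideanSpace ℝ (Fin 4)) 𝓘(ℝ, EuclideanSpace ℝ (Fin 4))
        ∞ (A : EuclideanSpace ℝ (Fin 4) → EuclideanSpace ℝ (Fin 4)) := by
      rw [contMDiff_iff_contDiff]
      exact contDiff_const_smul δ
    exact (he.contMDiff.comp h1).contMDiffOn
  have hgAs' : ContMDiffOn (𝓡 4) 𝓘(ℝ, EuclideanSpace ℝ (Fin 4)) ∞ gA.symm gA.target := by
    have h1 : ContMDiff 𝓘(ℝ, EuclideanSpace ℝ (Fin 4)) 𝓘(ℝ, EuclideanSpace ℝ (Fin 4))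
        ∞ (A.symm : EuclideanSpace ℝ (Fin 4) → EuclideanSpace ℝ (Fin 4)) := by
      rw [contMDiff_iff_contDiff]
      exact contDiff_const_smul δ⁻¹
    have h2 : gA.target ⊆ c.source := by
      rw [hgA_def, OpenPartialHomeomorph.trans_target]
      exact inter_subset_left
    have h3 : ContMDiffOn (𝓡 4) 𝓘(ℝ, EuclideanSpace ℝ (Fin 4)) ∞
        ((A.symm : EuclideanSpace ℝ (Fin 4) → EuclideanSpace ℝ (Fin 4)) ∘ c) c.source :=
      h1.comp_contMDiffOn hcs
    exact (h3.mono h2).congr fun x _ => rfl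
  set jA : Metric.closedBall (0 : EuclideanSpace ℝ (Fin 4)) 1 → S := gA ∘ Subtype.val with hjA_def
  have hjA : ∀ a, jA a = c.symm (δ • (a : EuclideanSpace ℝ (Fin 4))) := fun a => rfl
  have hembA : Manifold.IsSmoothEmbedding (𝓡∂ 4) (𝓡 4) ∞ jA :=
    isSmoothEmbedding_comp_coe_closedBall (n := 3) gA hgAs hgAs' hgAsrc
  have hjA_zero : ∀ a : Metric.closedBall (0 : EuclideanSpace ℝ (Fin 4)) 1,
      (a : EuclideanSpace ℝ (Fin 4)) = 0 → jA a = p := fun a ha => by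
    rw [hjA, ha, smul_zero]
    exact hp
  have hjA_ne : ∀ a : Metric.closedBall (0 : EuclideanSpace ℝ (Fin 4)) 1,
      (a : EuclideanSpace ℝ (Fin 4)) ≠ 0 → jA a ≠ p := fun a ha h => by
    rw [hjA, ← hp] at h
    exact ha ((smul_eq_zero.1 (hinj h)).resolve_left hδ.ne')
  -- on the first disc, off the centre, `Φ ∘ jA` is `a ↦ ι (δ • a)`
  have hΦjA : ∀ (a : Metric.closedBall (0 : EuclideanSpace ℝ (Fin 4)) 1)
      (ha : (a : EuclideanSpace ℝ (Fin 4)) ≠ 0),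
      Φ ⟨jA a, mem_punctured.2 (hjA_ne a ha)⟩ =
        sphereInversion (δ • (a : EuclideanSpace ℝ (Fin 4))) := by
    intro a ha
    have h := hΦ ⟨jA a, mem_punctured.2 (hjA_ne a ha)⟩ (δ • (a : EuclideanSpace ℝ (Fin 4))) rfl
      (by
        rw [hnormδ]
        exact (mul_le_of_le_one_right hδ.le (mem_closedBall_zero_iff.1 a.2)).trans_lt hδρ)
    rw [h]
    rfl
  have hnormΦjA : ∀ (a : Metric.closedBall (0 : EuclideanSpace ℝ (Fin 4)) 1)
      (ha : (a : EuclideanSpace ℝ (Fin 4)) ≠ 0),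
      ‖Φ ⟨jA a, mem_punctured.2 (hjA_ne a ha)⟩‖ =
        (δ * ‖(a : EuclideanSpace ℝ (Fin 4))‖)⁻¹ := fun a ha => by
    rw [hΦjA a ha, sphereInversion.norm_apply, hnormδ]
  -- the second disc: `Φ⁻¹` of the closed ball of radius `δ⁻¹`
  have hPne : Nonempty (punctured p) := ⟨Φ.symm 0⟩
  set B : EuclideanSpace ℝ (Fin 4) ≃ₜ EuclideanSpace ℝ (Fin 4) :=
    Homeomorph.smulOfNeZero δ⁻¹ hδinv.ne' with hB_def
  set gB : OpenPartialHomeomorph (EuclideanSpace ℝ (Fin 4)) S :=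
    (B.toOpenPartialHomeomorph ≫ₕ Φ.symm.toHomeomorph.toOpenPartialHomeomorph) ≫ₕ
      (punctured p).openPartialHomeomorphSubtypeCoe hPne with hgB_def
  have hgBsrc : gB.source = univ := by
    rw [hgB_def, OpenPartialHomeomorph.trans_source, OpenPartialHomeomorph.trans_source]
    simp
  have hgBtgt : gB.target ⊆ {p}ᶜ := by
    rw [hgB_def, OpenPartialHomeomorph.trans_target,
      TopologicalSpace.Opens.openPartialHomeomorphSubtypeCoe_target]
    exact inter_subset_left
  have hgBs : ContMDiffOn 𝓘(ℝ, EuclideanSpace ℝ (Fin 4)) (𝓡 4) ∞ gB gB.source := by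
    have h1 : ContMDiff 𝓘(ℝ, EuclideanSpace ℝ (Fin 4)) 𝓘(ℝ, EuclideanSpace ℝ (Fin 4))
        ∞ (B : EuclideanSpace ℝ (Fin 4) → EuclideanSpace ℝ (Fin 4)) := by
      rw [contMDiff_iff_contDiff]
      exact contDiff_const_smul δ⁻¹
    have h2 : ContMDiff 𝓘(ℝ, EuclideanSpace ℝ (Fin 4)) (𝓡 4) ∞
        (fun u => (Φ.symm (δ⁻¹ • u) : S)) :=
      (contMDiff_subtype_val (I := 𝓡 4) (n := ∞) (U := punctured p)).comp
        (Φ.symm.contMDiff.comp h1)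
    exact h2.contMDiffOn
  have hgBs' : ContMDiffOn (𝓡 4) 𝓘(ℝ, EuclideanSpace ℝ (Fin 4)) ∞ gB.symm gB.target := by
    set ci := (punctured p).openPartialHomeomorphSubtypeCoe hPne with hci_def
    have h1 : ContMDiffOn (𝓡 4) (𝓡 4) ∞ ci.symm {p}ᶜ := by
      intro x hx
      rw [← ContMDiffWithinAt.subtypeVal_comp_iff]
      refine (contMDiffWithinAt_id (I := 𝓡 4) (n := ∞)).congr (fun y hy => ?_) ?_
      · exact ci.right_inv
          (by rwa [hci_def, TopologicalSpace.Opens.openPartialHomeomorphSubtypeCoe_target])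
      · exact ci.right_inv
          (by rwa [hci_def, TopologicalSpace.Opens.openPartialHomeomorphSubtypeCoe_target])
    have h2 : ContMDiff 𝓘(ℝ, EuclideanSpace ℝ (Fin 4)) 𝓘(ℝ, EuclideanSpace ℝ (Fin 4))
        ∞ (B.symm : EuclideanSpace ℝ (Fin 4) → EuclideanSpace ℝ (Fin 4)) := by
      rw [contMDiff_iff_contDiff]
      have : (B.symm : EuclideanSpace ℝ (Fin 4) → EuclideanSpace ℝ (Fin 4)) = fun u => δ • u := by
        funext u
        rw [Homeomorph.symm_apply_eq]
        show u = δ⁻¹ • (δ • u)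
        rw [smul_smul, inv_mul_cancel₀ hδ.ne', one_smul]
      rw [this]
      exact contDiff_const_smul δ
    have h3 : ContMDiffOn (𝓡 4) 𝓘(ℝ, EuclideanSpace ℝ (Fin 4)) ∞
        (fun x => B.symm (Φ (ci.symm x))) {p}ᶜ :=
      (h2.comp Φ.contMDiff).comp_contMDiffOn h1
    exact h3.mono hgBtgt
  set jB : Metric.closedBall (0 : EuclideanSpace ℝ (Fin 4)) 1 → S := gB ∘ Subtype.val with hjB_def
  have hjB : ∀ b, jB b = (Φ.symm (δ⁻¹ • (b : EuclideanSpace ℝ (Fin 4))) : S) := fun b => rfl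
  have hembB : Manifold.IsSmoothEmbedding (𝓡∂ 4) (𝓡 4) ∞ jB :=
    isSmoothEmbedding_comp_coe_closedBall (n := 3) gB hgBs hgBs'
      (by rw [hgBsrc]; exact subset_univ _)
  have hjB_ne : ∀ b, jB b ≠ p := fun b => hne _
  have hΦjB : ∀ b, Φ ⟨jB b, mem_punctured.2 (hjB_ne b)⟩ =
      δ⁻¹ • (b : EuclideanSpace ℝ (Fin 4)) := fun b => by
    have : (⟨jB b, mem_punctured.2 (hjB_ne b)⟩ : punctured p) =
        Φ.symm (δ⁻¹ • (b : EuclideanSpace ℝ (Fin 4))) := Subtype.ext rfl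
    rw [this, Diffeomorph.apply_symm_apply]
  have hnormΦjB : ∀ b, ‖Φ ⟨jB b, mem_punctured.2 (hjB_ne b)⟩‖ ≤ δ⁻¹ := fun b => by
    rw [hΦjB, norm_smul, Real.norm_eq_abs, abs_of_pos hδinv]
    exact mul_le_of_le_one_right hδinv.le (mem_closedBall_zero_iff.1 b.2)
  -- assemble the gluing
  refine ⟨jA, jB, hembA, hembB, ?_, fun a b => ?_⟩
  · -- the two discs cover `S`
    refine eq_univ_of_forall fun x => ?_
    by_cases hxp : x = p
    · refine Or.inl ⟨⟨0, by simp⟩, ?_⟩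
      rw [hxp]
      exact hjA_zero _ rfl
    set u : EuclideanSpace ℝ (Fin 4) := Φ ⟨x, mem_punctured.2 hxp⟩ with hu
    by_cases hux : ‖u‖ ≤ δ⁻¹
    · refine Or.inr ⟨⟨δ • u, ?_⟩, ?_⟩
      · rw [mem_closedBall_zero_iff, hnormδ]
        have := mul_le_mul_of_nonneg_left hux hδ.le
        rwa [mul_inv_cancel₀ hδ.ne'] at this
      · show (Φ.symm (δ⁻¹ • (δ • u)) : S) = x
        rw [smul_smul, inv_mul_cancel₀ hδ.ne', one_smul, hu, Diffeomorph.symm_apply_apply]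
    · have hult : δ⁻¹ < ‖u‖ := not_le.1 hux
      have hu0 : u ≠ 0 := fun h => by
        rw [h, norm_zero] at hult
        exact lt_irrefl _ (hδinv.trans hult)
      set y : EuclideanSpace ℝ (Fin 4) := sphereInversion u with hy
      have hy0 : y ≠ 0 := sphereInversion.ne_zero hu0
      have hylt : ‖y‖ < δ := by
        rw [hy, sphereInversion.norm_apply]
        exact (inv_lt_comm₀ (norm_pos_iff.2 hu0) hδ).2 hult
      have ha1 : ‖δ⁻¹ • y‖ ≤ 1 := by
        rw [norm_smul, Real.norm_eq_abs, abs_of_pos hδinv]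
        have := mul_le_mul_of_nonneg_left hylt.le hδinv.le
        rwa [inv_mul_cancel₀ hδ.ne'] at this
      set a : Metric.closedBall (0 : EuclideanSpace ℝ (Fin 4)) 1 :=
        ⟨δ⁻¹ • y, mem_closedBall_zero_iff.2 ha1⟩ with ha
      have ha0 : (a : EuclideanSpace ℝ (Fin 4)) ≠ 0 := smul_ne_zero hδinv.ne' hy0
      refine Or.inl ⟨a, ?_⟩
      have h1 : Φ ⟨jA a, mem_punctured.2 (hjA_ne a ha0)⟩ = u := by
        rw [hΦjA a ha0]
        show sphereInversion (δ • (δ⁻¹ • y)) = u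
        rw [smul_smul, mul_inv_cancel₀ hδ.ne', one_smul, hy, sphereInversion.apply_apply]
      exact congrArg Subtype.val (Φ.injective (h1.trans hu))
  · -- the discs meet exactly along the unit sphere, identically
    constructor
    · intro hab
      have ha0 : (a : EuclideanSpace ℝ (Fin 4)) ≠ 0 := fun h =>
        hjB_ne b (hab ▸ hjA_zero a h)
      have hpt : (⟨jA a, mem_punctured.2 (hjA_ne a ha0)⟩ : punctured p) =
          ⟨jB b, mem_punctured.2 (hjB_ne b)⟩ := Subtype.ext hab
      have hnorm1 : ‖(a : EuclideanSpace ℝ (Fin 4))‖ = 1 := by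
        have hle : (δ * ‖(a : EuclideanSpace ℝ (Fin 4))‖)⁻¹ ≤ δ⁻¹ := by
          rw [← hnormΦjA a ha0, hpt]
          exact hnormΦjB b
        have hpos : 0 < δ * ‖(a : EuclideanSpace ℝ (Fin 4))‖ :=
          mul_pos hδ (norm_pos_iff.2 ha0)
        have h1 : δ ≤ δ * ‖(a : EuclideanSpace ℝ (Fin 4))‖ := (inv_le_inv₀ hpos hδ).1 hle
        have h2 : 1 ≤ ‖(a : EuclideanSpace ℝ (Fin 4))‖ := by
          by_contra h
          exact absurd h1 (not_le.2 (mul_lt_of_lt_one_right hδ (not_le.1 h)))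
        exact le_antisymm (mem_closedBall_zero_iff.1 a.2) h2
      have hιa : sphereInversion (a : EuclideanSpace ℝ (Fin 4)) = a := by
        rw [sphereInversion.apply_def, hnorm1, one_pow, inv_one, one_smul]
      have hab' : (a : EuclideanSpace ℝ (Fin 4)) = b := by
        have h1 : δ⁻¹ • (a : EuclideanSpace ℝ (Fin 4)) =
            δ⁻¹ • (b : EuclideanSpace ℝ (Fin 4)) := by
          rw [← hΦjB b, ← hpt, hΦjA a ha0, sphereInversion.apply_smul, hιa]
        exact smul_right_injective _ hδinv.ne' h1
      refine ⟨⟨a, mem_sphere_zero_iff_norm.2 hnorm1⟩, Subtype.ext rfl, Subtype.ext ?_⟩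
      rw [Diffeomorph.coe_refl]
      exact hab'.symm
    · rintro ⟨⟨zv, hz⟩, rfl, rfl⟩
      rw [Diffeomorph.coe_refl, id]
      set a : Metric.closedBall (0 : EuclideanSpace ℝ (Fin 4)) 1 :=
        (closedBallBoundaryData 3).incl ⟨zv, hz⟩ with ha
      have haz : (a : EuclideanSpace ℝ (Fin 4)) = zv := rfl
      have hnorm1 : ‖(a : EuclideanSpace ℝ (Fin 4))‖ = 1 := by
        rw [haz]; exact mem_sphere_zero_iff_norm.1 hz
      have ha0 : (a : EuclideanSpace ℝ (Fin 4)) ≠ 0 := by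
        rw [← norm_ne_zero_iff, hnorm1]; exact one_ne_zero
      have hιa : sphereInversion (a : EuclideanSpace ℝ (Fin 4)) = a := by
        rw [sphereInversion.apply_def, hnorm1, one_pow, inv_one, one_smul]
      have h1 : Φ ⟨jA a, mem_punctured.2 (hjA_ne a ha0)⟩ =
          Φ ⟨jB a, mem_punctured.2 (hjB_ne a)⟩ := by
        rw [hΦjA a ha0, hΦjB a, sphereInversion.apply_smul, hιa]
      exact congrArg Subtype.val (Φ.injective h1)

/-- **Endgame of the round-seam rung: a compact smooth `4`-manifold `S` whose puncture
`S ∖ {e 0}` is diffeomorphic to `ℝ⁴` by a diffeomorphism equal to `L ∘ ι ∘ e⁻¹` near the puncture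
is diffeomorphic to `S⁴`.**  Here `e : ℝ⁴ → S` is a smooth embedding of the whole model space,
`ι z = z / ‖z‖²` (`Literature.Geometry.Symplectic.inversion`), `L` an invertible continuous linear
map, and the agreement `Φ x = L (ι y)` is required for `x = e y`, `‖y‖ < ρ`.  Proof: `L⁻¹ ∘ Φ`
agrees with `ι ∘ e⁻¹` there, so `S` is the double `𝔻⁴ ∪_{id} 𝔻⁴`
(`isTwistedSphere_refl_of_diffeomorph_punctured_chartBall`), as is `S⁴`
(`Literature.Topology.FourManifolds.isTwistedSphere_refl_sphere`), and two gluings of two discs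
along the same diffeomorphism are diffeomorphic
(`Literature.Topology.FourManifolds.nonempty_diffeomorph_of_isTwistedSphere`; Hirsch 1976, Ch. 8,
Thm. 2.1).  Milnor (1965), §9. [cite: Hirsch1976, Ch. 8 Thm. 2.1] -/
theorem helper_sphere_of_diffeomorph_punctured_chartBall :
    ∀ (S : Type) [TopologicalSpace S] [T2Space S] [SecondCountableTopology S] [CompactSpace S]
      [ChartedSpace (EuclideanSpace ℝ (Fin 4)) S] [IsManifold (𝓡 4) ∞ S]
      (e : EuclideanSpace ℝ (Fin 4) → S)
      (L : EuclideanSpace ℝ (Fin 4) ≃L[ℝ] EuclideanSpace ℝ (Fin 4)) (ρ : ℝ)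
      (Φ : (Literature.Geometry.Symplectic.punctured (e 0)) ≃ₘ⟮𝓡 4, 𝓡 4⟯
        EuclideanSpace ℝ (Fin 4)),
      Manifold.IsSmoothEmbedding (𝓡 4) (𝓡 4) ∞ e → 0 < ρ →
      (∀ (x : (Literature.Geometry.Symplectic.punctured (e 0))) (y : EuclideanSpace ℝ (Fin 4)),
        x.1 = e y → ‖y‖ < ρ → Φ x = L (Literature.Geometry.Symplectic.inversion y)) →
      Nonempty (S ≃ₘ⟮𝓡 4, 𝓡 4⟯ Metric.sphere (0 : EuclideanSpace ℝ (Fin 5)) 1) := by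
  intro S _ _ _ _ _ _ e L ρ Φ he hρ hΦ
  have h : IsTwistedSphere 3
      (Diffeomorph.refl (𝓡 3) (Metric.sphere (0 : EuclideanSpace ℝ (Fin 4)) 1) ∞) S := by
    refine isTwistedSphere_refl_of_diffeomorph_punctured_chartBall e he hρ rfl
      (Φ.trans L.symm.toDiffeomorph) fun x y hx hy => ?_
    rw [Diffeomorph.coe_trans, comp_apply, ContinuousLinearEquiv.coe_toDiffeomorph, hΦ x y hx hy,
      ContinuousLinearEquiv.symm_apply_apply]
  exact nonempty_diffeomorph_of_isTwistedSphere h (isTwistedSphere_refl_sphere isDouble_sphere_holds)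

end Summit.SmoothPoincare4.SmoothPoincare4.Theorems.OrigamiFoldExistence.StableSeamHost

end
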